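import Literature.NumberTheory.LFunctions.MoebiusWalshCircuitsACdProofs
import Literature.Computability.Complexity.MoebiusBoundedDepthWalshProofs
import HarnessLib

/-!
# Green 2012, Theorem 1 for `μ` — the discharge of `green_moebius_ACd`

Topic `Literature/NumberTheory/LFunctions`, proofs-only sibling of `MoebiusWalshCircuits.lean`
(the named fact `Literature.NumberTheory.LFunctions.green_moebius_ACd`). B. Green, *On (not)
computing the Möbius function using bounded depth circuits*, Combin. Probab. Comput. **21** (2012)
942–951 (= arXiv:1103.4991) [Green2012], **Theorem 1**: "Suppose `N = 2ⁿ`. Let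
`F : {0,…,N-1} → {-1,1}` be an `AC⁰(d)` function. Then `𝔼_{0≤x≤N-1} μ(x)F(x) = O(e^{d log n - c n^{1/6d}})`,
where `c > 0` is an absolute constant."

Green proves Theorem 1 from his Proposition 1 (the Fourier–Walsh coefficients of `μ`) by the
§2 deduction (Parseval on the cube, the trivial bound on the low levels, Cauchy–Schwarz and the
Linial–Mansour–Nisan Fourier tails). Both halves are PROVED in the tree:

* the §2 deduction is `green_moebius_ACd_of_fourierWalsh` (`MoebiusWalshCircuitsACdProofs.lean`,
  with Tal's form of the Fourier-tail bound, `Circuit.l1Level_acBasis_le`/`ACForm.tailWeight_le_tailBound`);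
* Proposition 1 for `μ` (the named fact `green_moebius_fourierWalsh`) is
  `Literature.Computability.Complexity.green_moebius_fourierWalsh_holds`
  (`Computability/Complexity/MoebiusBoundedDepthWalshProofs.lean`: Kátai's Proposition 2, the
  minor-arc Proposition 4, the Harman–Kátai Lemma 1 and Corollary 2 of Theorem 3, assembled as
  printed in §§3–4, then transported along the proved bridge `Green2012_moebius_walshCoeff_iff`).

This file only composes them (`green_moebius_ACd_holds`); nothing else is here. The `Sieve`-topic
rendering `Literature.NumberTheory.Sieve.green_moebius_AC0` follows from it by the tree's
`Literature.NumberTheory.Sieve.green_moebius_AC0_of_ACd` (`Sieve/GreenMoebiusAC0Proofs.lean`).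

## References

* B. Green, Combin. Probab. Comput. 21 (2012) 942–951, Theorem 1, §2 (deduction from
  Proposition 1), §§3–4 (Proposition 1). [Green2012]
-/

namespace Literature.NumberTheory.LFunctions

/-- **Green 2012, Theorem 1 (Möbius is orthogonal to `AC⁰(d)` functions) — PROVED**: there are
absolute `c > 0`, `K` such that for `d, n ≥ 1` and every circuit `C` over `acBasis` on the `n`
binary digits with `depth ≤ d`, `size ≤ n^d`,
`|Σ_{x∈{0,1}ⁿ} μ(val x)(±1)^{C(x)}| / 2ⁿ ≤ K e^{d log n - c n^{1/(6d)}}` — Green's §2 deduction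
(`green_moebius_ACd_of_fourierWalsh`) applied to the proved Proposition 1
(`Literature.Computability.Complexity.green_moebius_fourierWalsh_holds`). [cite: Green2012, Theorem 1] -/
theorem green_moebius_ACd_holds : green_moebius_ACd :=
  green_moebius_ACd_of_fourierWalsh Literature.Computability.Complexity.green_moebius_fourierWalsh_holds

end Literature.NumberTheory.LFunctions
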